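import Summits.QuantumFields.BalabanUV.T4Continuum.Support.NE7EtaBackgroundCarrier

/-!
# NE7EtaBackgroundCloseness — route #1 of the NE7 crux, stub S7 (NODE O, the BACKGROUND COORDINATE): the closeness binder `hclose` of
# `T4TowerRateComposition.uRateUpTo_tower` PRODUCED on the carrier `NE7EtaBackgroundCarrier.bgCarriers` — CONDITIONAL on NE3's covariant root
# (amendment 4, UNCHANGED), the existence of the minimiser pair (hexA, hexB) and ONE smooth-gauge letter on the run-B minimiser displayed
# TOGETHER WITH the sector∕size side condition `hsector` (NEEDS-SIDE-CONDITION #S1)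

Cell `pub-balaban`, rung (B)+1 sub-cell t4, lineage `b2b-balaban-t4-ne7-p1`, generation 25 (CRUX PROVER NE7 #1, ruling e34b3e0c); crux
skeleton `t4/skeletons/NE7-CRUX-R1.md` v1.7.4 → v1.7.5 §3quinquies ∕ §5 (G5); Q-ne7p1-g24-1 answered GO-AMENDED by the crux refuter (F32,
amendments (1)–(3), tripwire (t15)); companion of `NE7EtaBackgroundCarrier` (the instance).  HONEST FRAMING (page 1): FIXED FINITE T⁴, rung
(B)+1; NE7, NE3 NOT PRINTED in [Balaban1984PropagatorsI]–[Balaban1989LargeFieldII] and NOT PROVED here; continuum YM on T⁴ ⇐ BetaPertH ∧ nine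
spine estimates (0/9 proved); BetaPertH ⇐ (D1) ∧ (D4) ∧ CAP+tail; G-an2-4 gates asym, D1 and NE2/3/4; NOT infinite volume, NOT mass gap, NOT
Clay.

WHAT.  `hclose_of_covRoot` (`d = 4`, gauge group `U(n)`, class `𝒞 = MinimalActionRate.sfClass 4 L N ε`).  HYPOTHESES (all displayed, none
printed, none a Literature fact):
 * lattice∕rate data `2 ≤ L`, `1 ≤ N`, `0 < θ`, `θ⁶ = L⁻¹`; class constant `0 ≤ ε` with the K-FREE multi-level smallness
   `∀ j, LevelSmall 4 L j (ε∕(L^{j+1})²)` (two k-free lines in `ε∕L²`, `NE3ClassRadiusFamily.levelSmall_of_small`); class data `b, g` with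
   `512·5·8·L²·b ≤ 1`; root data `C, Λ₁, Λ₂′`, budget `γ` with `C·ρ₄ ≤ γ³`, cube root `l₁` with `Λ₁ ≤ l₁³`;
 * `hdom` — `dom` is invariant under unitary `N`-periodic gauge transformations of the unit lattice (Bałaban's domains are; needed because
   the carrier's selections move the datum by corner values, (F3) of p256168);
 * `h` — NE3's COVARIANT ROOT, INTERFACE REQUEST NE7→NE3 amendment 4 VERBATIM (row NE3's unseated estimate T-E_w + (Lip₁ᶜ)(Lip₂′ᶜ));
 * `hexA` — run-A minimisers exist at every level `K ≥ 1` for every datum of `dom` ([Balaban1985Variational] Thm 1 p. 279 TYPE, one-run);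
 * `hexB` — DISPLAYED TOGETHER WITH `hsector : n·N²·ε ≤ c₀` (amendment (1); the antecedent of `hexB` is literally `hsector`'s inequality):
   for `K ≥ 1` and `v ∈ dom`, a run-B minimiser `U_B` at level `K+1` exists, is `Regular 4 L N b g (K+1)`, and IN SOME unitary
   `N·L^{K+1}`-periodic gauge `u_B` is bondwise `exp A_B` with `sup‖A_B‖ ≤ σ_B·θ^{6(K+1)}` on the WHOLE torus.  STATUS OF hexB (amendment (2)):
   the smooth-gauge letter is PRINTED ONLY LOCALLY — [Balaban1985Variational] Thm 1 (9) p. 279 gives `|A| < B₃Mε₁(L^jη)^{−1}` on a cube of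
   side `2ML^jη`, `M ≤ M(ε₁)`, in a gauge on a neighbourhood of the cube, and [Balaban1985PropagatorsII] (1.128)–(1.129) p. 98's cube-global axial
   gauge needs `α₀ ≤ O(1)M⁻¹`; the GLOBAL periodic letter above is an UNPRINTED torus globalisation (comb gauge + holonomy spreading +
   smoothing), satisfiable only in the trivial U(1)-flux ∕ Lüscher sector — which the side condition `n·N²·ε ≤ c₀` (flux quantisation, `c₀` a
   small absolute constant) enforces on the small-field class; WITHOUT it the letter is UNSATISFIABLE for flux data (refuter F32: witness
   `V_flux`, (42) preserves the flux exactly).  Its constant is `σ_B = σ_B(N)` (≍ B₃Nε₁), K-free but N-DEPENDENT; `C₃` below inherits the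
   N-dependence (harmless: `MatchingModConstants` carries the volume).  Asserted nowhere; never a `[cite]` fact (tripwire (t15)).
 * the carrier's class binders: `1 ∈ admA k`, `1 ∈ admB k`, minimisers for data of `dom` lie in the classes, `mapsTo` — discharged by
   construction for `NE7EtaBackgroundCarrier.occCarriers` (`hclose_of_covRoot_occ`).
CONCLUSION: selections `uA : ℕ → cfg → C.BgA`, `uB : ℕ → cfg → C.BgB`, a v-free threshold `K₀` and ONE `C₃ ≥ 0` with
 (a) for `K ≥ K₀`, `v ∈ dom`: `uA K v = (K, U_A^{w_A})`, `uB K v = (K, U_B^{w_B})` — GAUGE COPIES (unitary, periodic `w_A`, `w_B`) OF A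
     MINIMISER PAIR `(U_A, U_B)` FOR THE DATUM `v` ITSELF at levels `K`, `K+1` (so a gauge-invariant functional reads Bałaban's object — bill
     (G5) item (4), the functionals' invariance binder, is what the consumer adds; nothing here needs it);
 (b) below `K₀` or off `dom` the selections read the trivial background `(K, 1)` — FINITE-PREFIX rider: the finitely many cutoffs below the
     v-free threshold `K₀ = max(1, k_fit, k_(P), k_smooth)` ride in `C₃` (`NE7EtaRatesD4.exists_geometric_majorant`);
 (c) `∀ K, ∀ v ∈ dom, C.gauge (uA K v) (C.transport (uB K v)) ≤ C₃·θ^K` — LITERALLY the binder `hclose` of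
     `T4TowerRateComposition.uRateUpTo_tower` with `Adm := fun _ => dom`, `δc K := C₃θ^K` (and `argBracket_tower`'s `hδ0`, `hδ` with
     `θ₃ = θ = L^{−1∕6} < 1`).
PROOF (composition of landed modules, no new estimate): thresholds by `exists_fit_threshold` (fit `γ(θ^K)² ≤ l₁N`, (P)-smallness
`8l₁²γθ^{8K} ≤ 1`, smooth-gauge smallness `10Lσ_Bθ^{6(K+1)} ≤ 1∕64`); `Classical.choice` on hexA∕hexB; re-gauge the pair by `(u_B∘(L•), u_B)`
(`NE7EtaRegularGaugeInvariance.covRoot_hypotheses_gaugeAct`; the moved datum `ū_B·v ∈ dom` by `hdom`); the END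
`NE7EtaSmoothGaugeTransport.plain_closeness_of_covRoot₂_oneLetter` at the moved datum; `plainReading_le_rate`; geometric majorant.
`C₃ ≥ 16l₁²γ + 4l₁√(2γΛ₂′) + 960l₁²γσ_B + 128l₁⁴γ²` up to the prefix.
BILL (G5) AFTER THIS FILE: (1) carrier ✓ (`bgCarriers`∕`occCarriers`), (2) gauge ✓, (5) `hclose` ✓ IN KERNEL modulo the HYPOTHESES above,
(6) `mapsTo` ✓ by construction; OPEN: NE3's root (row NE3, amendment 4), hexA∕hexB = «LOCAL printed-TYPE + UNPRINTED globalisation under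
`hsector`, S–M» (amendment (3)), (4) the functionals' gauge-invariance binder and the functionals themselves (T.2's `ι`, (F1)∕(F4)).
HONEST.  Bookkeeping ([folklore]); root, hexA, hexB are HYPOTHESES; nothing of NE3∕NE7 discharged; nothing printed is a hypothesis-free
input; 0 def; 0 sorry.
-/

set_option autoImplicit false

open scoped BigOperators Matrix Matrix.Norms.L2Operator
open Finset NormedSpace

namespace Summit.QuantumFields.BalabanUV.T4Continuum.NE7EtaBackgroundCloseness

open Literature.MathematicalPhysics.QuantumFieldTheory.Balaban1983to89
open B7Prop1Explicit B7Prop2Explicit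
open T4AveragingDeficitWall hiding Site Plane Plaq Bond
open T4AveragingDeficitWallBoundary (periodBox IsPeriodicCfg)
open T4OutputRate (Carriers)
open AveragingDeficitPeriodicCounting (IsPeriodicDir)
open AveragingDeficitMultiLevelPrep (LevelSmall)
open MinimalActionSandwich (IsMinimiser)
open MinimalActionRate (Regular sfClass)
open NE3EnergyShapes (residualScale IsUnitarySite IsPeriodicSite)
open NE3EnergyWeightedShapes (energyNormW)
open AveragingDeficitDualResidual (dualC1 dualC2)
open AveragingDeficitDerivWallProof (wallConst)
open NE7EtaBackgroundCarrier

noncomputable section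

variable {n : Type} [Fintype n] [DecidableEq n] [Nonempty n]

/-! ## §1 The closeness binder on `bgCarriers` (abstract classes) -/

/-- **THE CLOSENESS BINDER `hclose` OF `uRateUpTo_tower` ON THE BACKGROUND-COORDINATE CARRIER, CONDITIONAL** (module docstring: hypotheses
`h` = NE3's covariant root amendment 4 verbatim, `hexA`, `hexB` displayed with `hsector` — LOCAL printed-TYPE ([Balaban1985Variational] Thm 1
(9) p. 279) + UNPRINTED torus globalisation, `σ_B = σ_B(N)`, asserted nowhere —, `hdom`, K-free `LevelSmall`, the carrier's class binders;
conclusion (a) the selections are gauge copies of a minimiser pair for the datum itself from the v-free threshold `K₀` on, (b) the trivial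
background below it, (c) `∀ K, ∀ v ∈ dom, C.gauge (uA K v) (C.transport (uB K v)) ≤ C₃·θ^K`). [folklore] -/
theorem hclose_of_covRoot {L N : ℕ} (hL : 2 ≤ L) (hN : 1 ≤ N) {θ : ℝ} (hθ : 0 < θ)
    (hθ6 : θ ^ 6 = ((L : ℝ))⁻¹) {ε : ℝ} (hε : 0 ≤ ε) (hls : ∀ j : ℕ, LevelSmall 4 L j (ε / ((L : ℝ) ^ (j + 1)) ^ 2))
    {b g C Λ₁ Λ₂' : ℝ} (hb : 0 ≤ b) (hbs : 512 * (4 + 1) * (4 + 4) * (L : ℝ) ^ 2 * b ≤ 1) (hg : 0 ≤ g) (hC : 0 ≤ C)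
    (hΛ₂' : 0 < Λ₂') {dom : Set (Site 4 → Fin 4 → (Matrix n n ℂ)ˣ)}
    (hdom : ∀ v ∈ dom, ∀ w : Site 4 → (Matrix n n ℂ)ˣ, IsUnitarySite w → IsPeriodicSite w (N : ℤ) → gaugeAct w v ∈ dom)
    (h : ∀ k : ℕ, 1 ≤ k → ∀ V ∈ dom, ∀ UA UB : Site 4 → Fin 4 → (Matrix n n ℂ)ˣ,
      IsMinimiser 4 (sfClass 4 L N ε) L N k V UA → IsMinimiser 4 (sfClass 4 L N ε) L N (k + 1) V UB →
        Regular 4 L N b g (k + 1) UB →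
        ∃ (u : Site 4 → (Matrix n n ℂ)ˣ) (Z : Site 4 → Fin 4 → Matrix n n ℂ),
          IsUnitarySite u ∧ IsPeriodicSite u ((N * L ^ k : ℕ) : ℤ) ∧
          IsSkewDir Z ∧ IsPeriodicDir Z ((N * L ^ k : ℕ) : ℤ) ∧
          gaugeAct u UA = vary (rescale L (bavg L UB)) Z 1 ∧
          energyNormW L k (rescale L (bavg L UB)) Z (periodBox (N * L ^ k)) ≤ C * residualScale 4 L N b g k ∧
          (∀ (κ : Fin 4) (x : Site 4) (μ : Fin 4),
            ‖Ad (rescale L (bavg L UB) (x + e κ) μ) (Z (x + e μ) κ) - Z x κ‖ ≤ Λ₁ * (((L : ℝ)⁻¹) ^ k) ^ 2) ∧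
          (∀ (κ μ : Fin 4) (y : Site 4),
            ‖Ad (rescale L (bavg L UB) (y + e κ) μ)
                (Ad (rescale L (bavg L UB) (y + e κ + e μ) μ) (Z (y + (2 : ℕ) • e μ) κ) - Z (y + e μ) κ)
              - (Ad (rescale L (bavg L UB) (y + e κ) μ) (Z (y + e μ) κ) - Z y κ)‖ ≤ Λ₂' * (((L : ℝ)⁻¹) ^ k) ^ 3))
    {γ l₁ : ℝ} (hγ : 0 < γ)
    (hγ3 : C * (wallConst 4 L * (N : ℝ) ^ 2 * (Real.sqrt g * dualC2 4 L + 2 * b ^ 2 * dualC1 4 L)) ≤ γ ^ 3)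
    (hl₁ : 0 < l₁) (hΛl₁ : Λ₁ ≤ l₁ ^ 3)
    (hexA : ∀ K : ℕ, 1 ≤ K → ∀ v ∈ dom, ∃ UA : Site 4 → Fin 4 → (Matrix n n ℂ)ˣ, IsMinimiser 4 (sfClass 4 L N ε) L N K v UA)
    {σB c₀ : ℝ} (hσB : 0 ≤ σB) (hsector : (Fintype.card n : ℝ) * (N : ℝ) ^ 2 * ε ≤ c₀)
    (hexB : ∀ K : ℕ, 1 ≤ K → ∀ v ∈ dom, (Fintype.card n : ℝ) * (N : ℝ) ^ 2 * ε ≤ c₀ →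
      ∃ UB : Site 4 → Fin 4 → (Matrix n n ℂ)ˣ, IsMinimiser 4 (sfClass 4 L N ε) L N (K + 1) v UB ∧ Regular 4 L N b g (K + 1) UB ∧
        ∃ uB : Site 4 → (Matrix n n ℂ)ˣ, IsUnitarySite uB ∧ IsPeriodicSite uB ((N * L ^ (K + 1) : ℕ) : ℤ) ∧
          ∃ AB : Site 4 → Fin 4 → Matrix n n ℂ, ∀ (x : Site 4) (κ : Fin 4),
            ((gaugeAct uB UB x κ : (Matrix n n ℂ)ˣ) : Matrix n n ℂ) = exp (AB x κ) ∧ ‖AB x κ‖ ≤ σB * θ ^ (6 * (K + 1)))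
    (D : Type) (sc : D → ℕ) (dl : D → ℝ) (hdl : ∀ X, 0 ≤ dl X) {admA admB : ℕ → Set (Site 4 → Fin 4 → (Matrix n n ℂ)ˣ)}
    (hmaps : ∀ (k : ℕ) (U : Site 4 → Fin 4 → (Matrix n n ℂ)ˣ), U ∈ admB k → rescale L (bavg L U) ∈ admA k)
    (h1A : ∀ k, (1 : Site 4 → Fin 4 → (Matrix n n ℂ)ˣ) ∈ admA k) (h1B : ∀ k, (1 : Site 4 → Fin 4 → (Matrix n n ℂ)ˣ) ∈ admB k)
    (hadmA : ∀ K : ℕ, ∀ V ∈ dom, ∀ U : Site 4 → Fin 4 → (Matrix n n ℂ)ˣ, IsMinimiser 4 (sfClass 4 L N ε) L N K V U → U ∈ admA K)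
    (hadmB : ∀ K : ℕ, ∀ V ∈ dom, ∀ U : Site 4 → Fin 4 → (Matrix n n ℂ)ˣ,
      IsMinimiser 4 (sfClass 4 L N ε) L N (K + 1) V U → U ∈ admB K) :
    ∃ (uA : ℕ → (Site 4 → Fin 4 → (Matrix n n ℂ)ˣ) → (bgCarriers n L N D sc dl hdl admA admB hmaps).BgA)
      (uB : ℕ → (Site 4 → Fin 4 → (Matrix n n ℂ)ˣ) → (bgCarriers n L N D sc dl hdl admA admB hmaps).BgB) (K₀ : ℕ) (C₃ : ℝ),
      0 ≤ C₃ ∧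
      (∀ K : ℕ, K₀ ≤ K → ∀ v ∈ dom, ∃ (UA UB : Site 4 → Fin 4 → (Matrix n n ℂ)ˣ) (wA wB : Site 4 → (Matrix n n ℂ)ˣ),
        IsMinimiser 4 (sfClass 4 L N ε) L N K v UA ∧ IsMinimiser 4 (sfClass 4 L N ε) L N (K + 1) v UB ∧
        Regular 4 L N b g (K + 1) UB ∧ IsUnitarySite wA ∧ IsPeriodicSite wA ((N * L ^ K : ℕ) : ℤ) ∧
        IsUnitarySite wB ∧ IsPeriodicSite wB ((N * L ^ (K + 1) : ℕ) : ℤ) ∧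
        (uA K v).1 = (K, gaugeAct wA UA) ∧ (uB K v).1 = (K, gaugeAct wB UB)) ∧
      (∀ (K : ℕ) (v : Site 4 → Fin 4 → (Matrix n n ℂ)ˣ), ¬ (K₀ ≤ K ∧ v ∈ dom) →
        (uA K v).1 = (K, 1) ∧ (uB K v).1 = (K, 1)) ∧
      ∀ K : ℕ, ∀ v ∈ dom, (bgCarriers n L N D sc dl hdl admA admB hmaps).gauge (uA K v)
          ((bgCarriers n L N D sc dl hdl admA admB hmaps).transport (uB K v))
        ≤ C₃ * θ ^ K := by
  classical
  have hL1 : 1 ≤ L := by omega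
  have hL0 : (0 : ℝ) < L := by exact_mod_cast (by omega : 0 < L)
  have hθ1 : θ < 1 := theta_lt_one hL hθ hθ6
  have hθ1' : θ ≤ 1 := hθ1.le
  have hb1 : b < 1 := by
    have hL1r : (1 : ℝ) ≤ (L : ℝ) ^ 2 := one_le_pow₀ (by exact_mod_cast hL1)
    nlinarith
  have hNr : (0 : ℝ) < N := by exact_mod_cast (by omega : 0 < N)
  -- thresholds
  obtain ⟨k₁, hk₁⟩ := NE7EtaRatesD4.exists_fit_threshold hθ.le hθ1 γ (B := l₁ * N) (by positivity)
  obtain ⟨k₂, hk₂⟩ := NE7EtaRatesD4.exists_fit_threshold (θ := θ ^ 4) (by positivity)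
    (pow_lt_one₀ hθ.le hθ1 (by norm_num)) (8 * l₁ ^ 2 * γ) (B := 1) one_pos
  obtain ⟨k₃, hk₃⟩ := NE7EtaRatesD4.exists_fit_threshold (θ := θ ^ 3) (by positivity)
    (pow_lt_one₀ hθ.le hθ1 (by norm_num)) (10 * (L : ℝ) * σB) (B := 1 / 64) (by norm_num)
  set K₀ : ℕ := max (max 1 k₁) (max k₂ k₃) with hK₀
  -- total selection functions from hexA / hexB
  have hexA' : ∀ (K : ℕ) (v : Site 4 → Fin 4 → (Matrix n n ℂ)ˣ), ∃ UA : Site 4 → Fin 4 → (Matrix n n ℂ)ˣ,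
      1 ≤ K → v ∈ dom → IsMinimiser 4 (sfClass 4 L N ε) L N K v UA := by
    intro K v
    by_cases hk : 1 ≤ K ∧ v ∈ dom
    · obtain ⟨UA, hUA⟩ := hexA K hk.1 v hk.2
      exact ⟨UA, fun _ _ => hUA⟩
    · exact ⟨1, fun h1 h2 => (hk ⟨h1, h2⟩).elim⟩
  choose fA hfA using hexA'
  have hexB' : ∀ (K : ℕ) (v : Site 4 → Fin 4 → (Matrix n n ℂ)ˣ), ∃ (UB : Site 4 → Fin 4 → (Matrix n n ℂ)ˣ)
      (uB : Site 4 → (Matrix n n ℂ)ˣ) (AB : Site 4 → Fin 4 → Matrix n n ℂ), 1 ≤ K → v ∈ dom →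
        IsMinimiser 4 (sfClass 4 L N ε) L N (K + 1) v UB ∧ Regular 4 L N b g (K + 1) UB ∧ IsUnitarySite uB ∧
        IsPeriodicSite uB ((N * L ^ (K + 1) : ℕ) : ℤ) ∧
        ∀ (x : Site 4) (κ : Fin 4), ((gaugeAct uB UB x κ : (Matrix n n ℂ)ˣ) : Matrix n n ℂ) = exp (AB x κ) ∧
          ‖AB x κ‖ ≤ σB * θ ^ (6 * (K + 1)) := by
    intro K v
    by_cases hk : 1 ≤ K ∧ v ∈ dom
    · obtain ⟨UB, hUB, hreg, uB, hu, huP, AB, hAB⟩ := hexB K hk.1 v hk.2 hsector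
      exact ⟨UB, uB, AB, fun _ _ => ⟨hUB, hreg, hu, huP, hAB⟩⟩
    · exact ⟨1, 1, 0, fun h1 h2 => (hk ⟨h1, h2⟩).elim⟩
  choose fB fuB fAB hfB using hexB'
  -- the constant
  set CO : ℝ := 16 * l₁ ^ 2 * γ + (4 * l₁ * Real.sqrt (2 * γ * Λ₂') + 16 * l₁ ^ 2 * γ * (60 * σB) + 128 * l₁ ^ 4 * γ ^ 2)
    with hCO
  -- the root applied to the re-gauged pair above the threshold
  have hsel : ∀ (K : ℕ) (v : Site 4 → Fin 4 → (Matrix n n ℂ)ˣ), ∃ u : Site 4 → (Matrix n n ℂ)ˣ, K₀ ≤ K → v ∈ dom →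
      IsUnitarySite u ∧ IsPeriodicSite u ((N * L ^ K : ℕ) : ℤ) ∧
      gaugeAct u (gaugeAct (fun x : Site 4 => fuB K v ((L : ℤ) • x)) (fA K v)) ∈ admA K ∧
      gaugeAct (fuB K v) (fB K v) ∈ admB K ∧
      plainReading L N K (gaugeAct u (gaugeAct (fun x : Site 4 => fuB K v ((L : ℤ) • x)) (fA K v)))
        (rescale L (bavg L (gaugeAct (fuB K v) (fB K v)))) ≤ CO * θ ^ K := by
    intro K v
    by_cases hKv : K₀ ≤ K ∧ v ∈ dom
    · obtain ⟨hK, hv⟩ := hKv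
      have hK1 : 1 ≤ K := le_trans (le_trans (le_max_left 1 k₁) (le_max_left _ _)) hK
      have hKk₁ : k₁ ≤ K := le_trans (le_trans (le_max_right 1 k₁) (le_max_left _ _)) hK
      have hKk₂ : k₂ ≤ K := le_trans (le_trans (le_max_left k₂ k₃) (le_max_right _ _)) hK
      have hKk₃ : k₃ ≤ K := le_trans (le_trans (le_max_right k₂ k₃) (le_max_right _ _)) hK
      obtain ⟨j, rfl⟩ : ∃ j, K = j + 1 := ⟨K - 1, by omega⟩
      have hA0 := hfA (j + 1) v hK1 hv
      obtain ⟨hB0, hreg0, hwu, hwp, hAB⟩ := hfB (j + 1) v hK1 hv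
      -- the re-gauged triple and the moved datum
      obtain ⟨hA', hB', hreg'⟩ :=
        NE7EtaRegularGaugeInvariance.covRoot_hypotheses_gaugeAct hL1 hε j (hls j) (hls (j + 1)) hb1 hA0 hB0 hreg0 hwu hwp
      have hV' : gaugeAct (fun w : Site 4 => fuB (j + 1) v (((L : ℤ) ^ (j + 2)) • w)) v ∈ dom :=
        hdom v hv _ (NE7EtaMinimiserGaugeCovariance.isUnitarySite_corner hwu _) (isPeriodicSite_corner hwp)
      -- the smallness lines at this level
      have hfit : γ * (θ ^ (j + 1)) ^ 2 ≤ l₁ * N := hk₁ (j + 1) hKk₁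
      have hp1 : 8 * l₁ ^ 2 * γ * θ ^ (8 * (j + 1)) ≤ 1 := by
        have h2 := hk₂ (j + 1) hKk₂
        have e : ((θ ^ 4) ^ (j + 1)) ^ 2 = θ ^ (8 * (j + 1)) := by rw [← pow_mul, ← pow_mul]; congr 1; ring
        rw [e] at h2
        exact h2
      have hsmooth : 10 * (L : ℝ) * (σB * θ ^ (6 * (j + 1 + 1))) ≤ 1 / 64 := by
        have h3 := hk₃ (j + 1 + 1) (by omega)
        have e : ((θ ^ 3) ^ (j + 1 + 1)) ^ 2 = θ ^ (6 * (j + 1 + 1)) := by rw [← pow_mul, ← pow_mul]; congr 1; ring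
        rw [e] at h3
        linarith
      obtain ⟨u, Z, hu, huP, -, -, -, hi, hii⟩ :=
        NE7EtaSmoothGaugeTransport.plain_closeness_of_covRoot₂_oneLetter (𝒞 := sfClass 4 L N ε) hL hN hθ hθ1' hθ6 hb hbs
          hg hC hΛ₂' h hγ hγ3 hl₁ hΛl₁ hK1 hfit hp1 hV' hA' hB' hreg' hσB hAB hsmooth
      refine ⟨u, fun _ _ => ⟨hu, huP, ?_, ?_, ?_⟩⟩
      · -- the run-A selection is a minimiser for a datum of `dom`
        have hmin := NE7EtaMinimiserGaugeCovariance.isMinimiser_gaugeAct hL1 hε j (hls j) hA' hu huP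
        exact hadmA (j + 1) _ (hdom _ hV' _ (NE7EtaMinimiserGaugeCovariance.isUnitarySite_corner hu _)
          (isPeriodicSite_corner huP)) _ hmin
      · exact hadmB (j + 1) _ hV' _ hB'
      · have hA16 : 0 ≤ 16 * l₁ ^ 2 * γ := by positivity
        have hCG : 0 ≤ 4 * l₁ * Real.sqrt (2 * γ * Λ₂') + 16 * l₁ ^ 2 * γ * (60 * σB) + 128 * l₁ ^ 4 * γ ^ 2 := by
          positivity
        exact plainReading_le_rate hθ hθ1' hθ6 hA16 hCG hi hii
    · exact ⟨1, fun h1 h2 => (hKv ⟨h1, h2⟩).elim⟩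
  choose fu hfu using hsel
  -- the geometric majorant over all cutoffs (the finitely many below `K₀` read the trivial background)
  set δ : ℕ → ℝ := fun K => if K₀ ≤ K then CO * θ ^ K
    else levelGauge L N (K, (1 : Site 4 → Fin 4 → (Matrix n n ℂ)ˣ)) (K, rescale L (bavg L (1 : Site 4 → Fin 4 → (Matrix n n ℂ)ˣ)))
    with hδ
  have hδK : ∀ K, K₀ ≤ K → δ K ≤ CO * θ ^ K := fun K hK => by simp only [hδ, if_pos hK, le_rfl]
  obtain ⟨C₃, hC₃, hmaj⟩ := NE7EtaRatesD4.exists_geometric_majorant hθ hδK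
  -- the selections
  refine ⟨fun K v => if hKv : K₀ ≤ K ∧ v ∈ dom then
      ⟨(K, gaugeAct (fu K v) (gaugeAct (fun x : Site 4 => fuB K v ((L : ℤ) • x)) (fA K v))), (hfu K v hKv.1 hKv.2).2.2.1⟩
      else ⟨(K, 1), h1A K⟩,
    fun K v => if hKv : K₀ ≤ K ∧ v ∈ dom then ⟨(K, gaugeAct (fuB K v) (fB K v)), (hfu K v hKv.1 hKv.2).2.2.2.1⟩
      else ⟨(K, 1), h1B K⟩, K₀, C₃, hC₃, ?_, ?_, ?_⟩
  · -- the selections are gauge copies of a minimiser pair for the datum itself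
    intro K hK v hv
    have hKv : K₀ ≤ K ∧ v ∈ dom := ⟨hK, hv⟩
    have hK1 : 1 ≤ K := le_trans (le_trans (le_max_left 1 k₁) (le_max_left _ _)) hK
    obtain ⟨hB0, hreg0, hwu, hwp, -⟩ := hfB K v hK1 hv
    obtain ⟨hu, huP, -, -, -⟩ := hfu K v hK hv
    obtain ⟨j, rfl⟩ : ∃ j, K = j + 1 := ⟨K - 1, by omega⟩
    refine ⟨fA (j + 1) v, fB (j + 1) v, fu (j + 1) v * fun x : Site 4 => fuB (j + 1) v ((L : ℤ) • x), fuB (j + 1) v,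
      hfA (j + 1) v hK1 hv, hB0, hreg0,
      isUnitarySite_mul hu (NE7EtaSmoothGaugeTransport.isUnitarySite_rescaleGauge L hwu),
      isPeriodicSite_mul huP (NE7EtaSmoothGaugeTransport.isPeriodicSite_rescaleGauge hwp), hwu, hwp, ?_, ?_⟩
    · simp only [dif_pos hKv, gaugeAct_mul']
    · simp only [dif_pos hKv]
  · intro K v hKv
    simp only [dif_neg hKv, and_self]
  · intro K v hv
    rw [bgCarriers_gauge, bgCarriers_transport_val]
    by_cases hK : K₀ ≤ K
    · have hKv : K₀ ≤ K ∧ v ∈ dom := ⟨hK, hv⟩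
      simp only [dif_pos hKv, levelGauge_same]
      have e : δ K = CO * θ ^ K := by simp only [hδ, if_pos hK]
      have hm := hmaj K
      rw [e] at hm
      exact ((hfu K v hK hv).2.2.2.2).trans hm
    · have hKv : ¬ (K₀ ≤ K ∧ v ∈ dom) := fun h' => hK h'.1
      simp only [dif_neg hKv]
      have e : δ K = levelGauge L N (K, (1 : Site 4 → Fin 4 → (Matrix n n ℂ)ˣ))
          (K, rescale L (bavg L (1 : Site 4 → Fin 4 → (Matrix n n ℂ)ˣ))) := by simp only [hδ, if_neg hK]
      rw [← e]
      exact hmaj K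

/-! ## §2 The same on the OCCURRING classes (no class binder left) -/

/-- **`hclose` ON THE CARRIER OF THE OCCURRING CLASSES** `NE7EtaBackgroundCarrier.occCarriers`: as `hclose_of_covRoot`, with the five class
binders discharged by construction (`one_mem_occA`, `one_mem_occB`, `rescale_bavg_mem_occA`, `minimiser_mem_occA`, `minimiser_mem_occB`) — the
only remaining data are `dom`, the class constant `ε`, the root∕class∕budget constants and the abstract domain catalogue. [folklore] -/
theorem hclose_of_covRoot_occ {L N : ℕ} (hL : 2 ≤ L) (hN : 1 ≤ N) {θ : ℝ} (hθ : 0 < θ)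
    (hθ6 : θ ^ 6 = ((L : ℝ))⁻¹) {ε : ℝ} (hε : 0 ≤ ε) (hls : ∀ j : ℕ, LevelSmall 4 L j (ε / ((L : ℝ) ^ (j + 1)) ^ 2))
    {b g C Λ₁ Λ₂' : ℝ} (hb : 0 ≤ b) (hbs : 512 * (4 + 1) * (4 + 4) * (L : ℝ) ^ 2 * b ≤ 1) (hg : 0 ≤ g) (hC : 0 ≤ C)
    (hΛ₂' : 0 < Λ₂') {dom : Set (Site 4 → Fin 4 → (Matrix n n ℂ)ˣ)}
    (hdom : ∀ v ∈ dom, ∀ w : Site 4 → (Matrix n n ℂ)ˣ, IsUnitarySite w → IsPeriodicSite w (N : ℤ) → gaugeAct w v ∈ dom)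
    (h : ∀ k : ℕ, 1 ≤ k → ∀ V ∈ dom, ∀ UA UB : Site 4 → Fin 4 → (Matrix n n ℂ)ˣ,
      IsMinimiser 4 (sfClass 4 L N ε) L N k V UA → IsMinimiser 4 (sfClass 4 L N ε) L N (k + 1) V UB →
        Regular 4 L N b g (k + 1) UB →
        ∃ (u : Site 4 → (Matrix n n ℂ)ˣ) (Z : Site 4 → Fin 4 → Matrix n n ℂ),
          IsUnitarySite u ∧ IsPeriodicSite u ((N * L ^ k : ℕ) : ℤ) ∧
          IsSkewDir Z ∧ IsPeriodicDir Z ((N * L ^ k : ℕ) : ℤ) ∧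
          gaugeAct u UA = vary (rescale L (bavg L UB)) Z 1 ∧
          energyNormW L k (rescale L (bavg L UB)) Z (periodBox (N * L ^ k)) ≤ C * residualScale 4 L N b g k ∧
          (∀ (κ : Fin 4) (x : Site 4) (μ : Fin 4),
            ‖Ad (rescale L (bavg L UB) (x + e κ) μ) (Z (x + e μ) κ) - Z x κ‖ ≤ Λ₁ * (((L : ℝ)⁻¹) ^ k) ^ 2) ∧
          (∀ (κ μ : Fin 4) (y : Site 4),
            ‖Ad (rescale L (bavg L UB) (y + e κ) μ)
                (Ad (rescale L (bavg L UB) (y + e κ + e μ) μ) (Z (y + (2 : ℕ) • e μ) κ) - Z (y + e μ) κ)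
              - (Ad (rescale L (bavg L UB) (y + e κ) μ) (Z (y + e μ) κ) - Z y κ)‖ ≤ Λ₂' * (((L : ℝ)⁻¹) ^ k) ^ 3))
    {γ l₁ : ℝ} (hγ : 0 < γ)
    (hγ3 : C * (wallConst 4 L * (N : ℝ) ^ 2 * (Real.sqrt g * dualC2 4 L + 2 * b ^ 2 * dualC1 4 L)) ≤ γ ^ 3)
    (hl₁ : 0 < l₁) (hΛl₁ : Λ₁ ≤ l₁ ^ 3)
    (hexA : ∀ K : ℕ, 1 ≤ K → ∀ v ∈ dom, ∃ UA : Site 4 → Fin 4 → (Matrix n n ℂ)ˣ, IsMinimiser 4 (sfClass 4 L N ε) L N K v UA)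
    {σB c₀ : ℝ} (hσB : 0 ≤ σB) (hsector : (Fintype.card n : ℝ) * (N : ℝ) ^ 2 * ε ≤ c₀)
    (hexB : ∀ K : ℕ, 1 ≤ K → ∀ v ∈ dom, (Fintype.card n : ℝ) * (N : ℝ) ^ 2 * ε ≤ c₀ →
      ∃ UB : Site 4 → Fin 4 → (Matrix n n ℂ)ˣ, IsMinimiser 4 (sfClass 4 L N ε) L N (K + 1) v UB ∧ Regular 4 L N b g (K + 1) UB ∧
        ∃ uB : Site 4 → (Matrix n n ℂ)ˣ, IsUnitarySite uB ∧ IsPeriodicSite uB ((N * L ^ (K + 1) : ℕ) : ℤ) ∧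
          ∃ AB : Site 4 → Fin 4 → Matrix n n ℂ, ∀ (x : Site 4) (κ : Fin 4),
            ((gaugeAct uB UB x κ : (Matrix n n ℂ)ˣ) : Matrix n n ℂ) = exp (AB x κ) ∧ ‖AB x κ‖ ≤ σB * θ ^ (6 * (K + 1)))
    (D : Type) (sc : D → ℕ) (dl : D → ℝ) (hdl : ∀ X, 0 ≤ dl X) :
    ∃ (uA : ℕ → (Site 4 → Fin 4 → (Matrix n n ℂ)ˣ) → (occCarriers n L N ε dom D sc dl hdl).BgA)
      (uB : ℕ → (Site 4 → Fin 4 → (Matrix n n ℂ)ˣ) → (occCarriers n L N ε dom D sc dl hdl).BgB) (K₀ : ℕ) (C₃ : ℝ),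
      0 ≤ C₃ ∧
      (∀ K : ℕ, K₀ ≤ K → ∀ v ∈ dom, ∃ (UA UB : Site 4 → Fin 4 → (Matrix n n ℂ)ˣ) (wA wB : Site 4 → (Matrix n n ℂ)ˣ),
        IsMinimiser 4 (sfClass 4 L N ε) L N K v UA ∧ IsMinimiser 4 (sfClass 4 L N ε) L N (K + 1) v UB ∧
        Regular 4 L N b g (K + 1) UB ∧ IsUnitarySite wA ∧ IsPeriodicSite wA ((N * L ^ K : ℕ) : ℤ) ∧
        IsUnitarySite wB ∧ IsPeriodicSite wB ((N * L ^ (K + 1) : ℕ) : ℤ) ∧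
        (uA K v).1 = (K, gaugeAct wA UA) ∧ (uB K v).1 = (K, gaugeAct wB UB)) ∧
      (∀ (K : ℕ) (v : Site 4 → Fin 4 → (Matrix n n ℂ)ˣ), ¬ (K₀ ≤ K ∧ v ∈ dom) →
        (uA K v).1 = (K, 1) ∧ (uB K v).1 = (K, 1)) ∧
      ∀ K : ℕ, ∀ v ∈ dom, (occCarriers n L N ε dom D sc dl hdl).gauge (uA K v)
          ((occCarriers n L N ε dom D sc dl hdl).transport (uB K v))
        ≤ C₃ * θ ^ K :=
  hclose_of_covRoot hL hN hθ hθ6 hε hls hb hbs hg hC hΛ₂' hdom h hγ hγ3 hl₁ hΛl₁ hexA hσB hsector hexB D sc dl hdl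
    (rescale_bavg_mem_occA L N ε dom) (one_mem_occA L N ε dom) (one_mem_occB L N ε dom) (minimiser_mem_occA L N ε dom)
    (minimiser_mem_occB L N ε dom)


end

end Summit.QuantumFields.BalabanUV.T4Continuum.NE7EtaBackgroundCloseness
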